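import Summits.QuantumFields.YangMills.Theorems.SqueezedSkewnessCeilingFromMoments
import Summits.QuantumFields.YangMills.Theorems.SqueezedSkewnessSqueezedFactorisationGlue
import Summits.QuantumFields.YangMills.Theorems.SqueezedSkewnessShellGeometry
import HarnessLib

/-!
# Route `SqueezedSkewness`, aside `SqueezedFactorisation` (stmt-QuantumFields-25917): the registered stub `stub_shell` BY NAME AND
# SIGNATURE, and the XL stub `stub_squeezeOnShells` REDUCED to `ShellSign ∧ ClauseOneMoments`

The registered birth skeleton `Cruxes/NT/Lines/squeezed_skewness_birth.lean` (planner ym-idea-6 g2) serves the two-sided parent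
`SqueezedFactorisation` through two stubs, `stub_shell` (M, geometry) and `stub_squeezeOnShells` (XL, the content), composed by
`SqueezedFactorisation_of`.  After the split (rev 14: `ShellGeometry` 27860 ✓, `ShellSign` 27861, `ClauseOneMoments` 27862,
`CeilingFromMoments` 27863 ✓ `Theorems/SqueezedSkewnessCeilingFromMoments.lean`, glue 27864 ✓) this file records, kernel-checked:

* `stub_shell` — the registered STUB by name and (spelled-out) signature, from the landed `squeezedSkewness_shellGeometry`;
* `squeezeOnShells_of_shellSign_clauseOneMoments` — **`ShellSign → ClauseOneMoments → stub_squeezeOnShells`**: the XL stub of the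
  skeleton is now EXACTLY the one-sided sign item plus the spine-currency item (the ceiling `|Q3| ≤ M` comes from the landed
  `CeilingFromMoments`, the bump's support lies in positive time since `ρ ≤ ℓ/2 ≤ 1/8`; arithmetic as in the landed glue:
  `c·Q2 ≤ σ·Q3 ≤ |Q3| ≤ M ≤ (M/ε)·Q2`, `C' = max(M/ε, 2c)`, `w = (c + C')/2`, `δ = (C' − c)/(C' + c) < 1`);
* `squeezedFactorisation_of_shellSign_clauseOneMoments` — the parent BY NAME from the two open children (landed glue + the two
  landed children).

Fleet lead `ym-spine-19353-p1` g21 (`--supports stmt-QuantumFields-25917`).  THEOREMS ONLY (the two stub statements are spelled out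
verbatim from the skeleton; no definitions).  HONEST FRAMING: `ShellSign` (27861) and `ClauseOneMoments` (27862) are OPEN (XL); the parent is an aside of the route — no crux, NT
statement, rung of record or mass gap is proved by any of this. [folklore]
-/

set_option autoImplicit false

noncomputable section

namespace Summit.QuantumFields.YangMills.Theorems.SqueezedSkewnessSqueezedFactorisationStubs

open Literature.MathematicalPhysics.QuantumFieldTheory Literature.MathematicalPhysics.QuantumLattice
open Summit.QuantumFields.YangMills.Cruxes.OSLegsFromFemtoAndGap.DlrCollarTransfer
open Summit.QuantumFields.YangMills.Theses.SqueezedSkewness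

/-! ## The registered STUB `stub_shell`, by name and signature -/

/-- **STUB `stub_shell` HOLDS** (registered on stmt-QuantumFields-25917): hyperoctahedrally symmetric non-negative Schwartz shells at
every femto radius with the disjointness geometry for bumps of half the radius — the landed `squeezedSkewness_shellGeometry`
(radial `ContDiffBump` profile). [folklore] -/
theorem stub_shell : ∀ ℓ : ℝ, 0 < ℓ → ℓ ≤ 1 / 4 → ∃ h : SchwartzMap (EuclideanSpace ℝ (Fin 4)) ℝ, ((∀ x, 0 ≤ h x) ∧ tsupport (h : EuclideanSpace ℝ (Fin 4) → ℝ) ⊆ Metric.closedBall (EuclideanSpace.single (0 : Fin 4) (1 : ℝ)) (2 * ℓ) \ Metric.ball (EuclideanSpace.single (0 : Fin 4) (1 : ℝ)) ℓ ∧ (∀ T : EuclideanSpace ℝ (Fin 4) ≃ₗᵢ[ℝ] EuclideanSpace ℝ (Fin 4), (∀ i : Fin 4, ∃ j : Fin 4, ∃ ε : ℝ, (ε = 1 ∨ ε = -1) ∧ T (EuclideanSpace.single i (1 : ℝ)) = ε • EuclideanSpace.single j (1 : ℝ)) → ∀ u : EuclideanSpace ℝ (Fin 4), h ((EuclideanSpace.single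 (0 : Fin 4) (1 : ℝ)) + T u) = h ((EuclideanSpace.single (0 : Fin 4) (1 : ℝ)) + u)) ∧ (∃ x, h x ≠ 0)) ∧ (∀ v : SchwartzMap (EuclideanSpace ℝ (Fin 4)) ℝ, tsupport (v : EuclideanSpace ℝ (Fin 4) → ℝ) ⊆ Metric.closedBall (EuclideanSpace.single (0 : Fin 4) (1 : ℝ)) (ℓ / 2) → Disjoint (tsupport (v : EuclideanSpace ℝ (Fin 4) → ℝ)) (tsupport (thetaTest 4 v : EuclideanSpace ℝ (Fin 4) → ℝ)) ∧ Disjoint (tsupport (thetaTest 4 v : EuclideanSpace ℝ (Fin 4) → ℝ)) (tsupport (h : EuclideanSpace ℝ (Fin 4) → ℝ)) ∧ Disjoint (tsupport (v : EuclideanSpace ℝ (Fin 4) → ℝ)) (tsupport (h : EuclideanSpace ℝ (Fin 4) → ℝ))) :=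
  Summit.QuantumFields.YangMills.Theorems.squeezedSkewness_shellGeometry

/-! ## The XL stub reduced to the two open children -/

/-- **`ShellSign → ClauseOneMoments → stub_squeezeOnShells`.**  Take the femto radius `ℓ` of `ShellSign`; for a symmetric shell `h`
take the bump radius `ρ ≤ ℓ/2` of `ShellSign h`; for a floor-carrying bump `v ⊆ closedBall(e₀, ρ)`: `c·Q2 ≤ σ·Q3` (`ShellSign`),
`MomentBounds6` at the unit (`ClauseOneMoments`; the bump lies in positive time since `ρ < 1`), `|Q3| ≤ M` (landed
`CeilingFromMoments`), `Q2 ≥ ε > 0`; with `C' = max(M/ε, 2c)`, `w = (c + C')/2`, `δ = (C' − c)/(C' + c) < 1` one gets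
`|Q3 − σ·w·Q2| ≤ δ·w·Q2`. [folklore] -/
theorem squeezeOnShells_of_shellSign_clauseOneMoments (hSign : ShellSign) (hPin : ClauseOneMoments) :
    ∀ (G : Type) [Group G] [TopologicalSpace G] [IsTopologicalGroup G] [CompactSpace G], IsCompactSimpleLieGroup G → letI : MeasurableSpace G := borel G; haveI : BorelSpace G := ⟨rfl⟩; ∀ (r : LatticeRep G) (a : ℝ → ℝ), (∀ β, 0 < a β) → Filter.Tendsto a Filter.atTop (nhds 0) → ∃ ℓ : ℝ, 0 < ℓ ∧ ℓ ≤ 1 / 4 ∧ ∀ h : SchwartzMap (EuclideanSpace ℝ (Fin 4)) ℝ, ((∀ x, 0 ≤ h x) ∧ tsupport (h : EuclideanSpace ℝ (Fin 4) → ℝ) ⊆ Metric.closedBall (EuclideanSpace.single (0 : Fin 4) (1 : ℝ)) (2 * ℓ) \ Metric.ball (EuclideanSpace.single (0 : Fin 4) (1 : ℝ)) ℓ ∧ (∀ T : EuclideanSpace ℝ (Fin 4) ≃ₗᵢ[ℝ] EuclideanSpace ℝ (Fin 4), (∀ i : Fin 4, ∃ j : Fin 4, ∃ ε : ℝ, (ε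 = 1 ∨ ε = -1) ∧ T (EuclideanSpace.single i (1 : ℝ)) = ε • EuclideanSpace.single j (1 : ℝ)) → ∀ u : EuclideanSpace ℝ (Fin 4), h ((EuclideanSpace.single (0 : Fin 4) (1 : ℝ)) + T u) = h ((EuclideanSpace.single (0 : Fin 4) (1 : ℝ)) + u)) ∧ (∃ x, h x ≠ 0)) → ∃ ρ : ℝ, 0 < ρ ∧ ρ ≤ ℓ / 2 ∧ ∀ v : SchwartzMap (EuclideanSpace ℝ (Fin 4)) ℝ, (∀ x, 0 ≤ v x) → tsupport (v : EuclideanSpace ℝ (Fin 4) → ℝ) ⊆ Metric.closedBall (EuclideanSpace.single (0 : Fin 4) (1 : ℝ)) ρ → (∃ ε β₅ Λ₅ : ℝ, 0 < ε ∧ ∀ β : ℝ, β₅ ≤ β → ∀ L : ℕ, Λ₅ ≤ a β * L → ε ≤ Q2 G r β L (a β) (thetaTest 4 v) v) → ∃ w δ σ : ℝ, 0 < w ∧ δ < 1 ∧ (σ = 1 ∨ σ = -1) ∧ ∃ β₆ Λ₆ : ℝ, ∀ β : ℝ, β₆ ≤ β → ∀ L : ℕ, Λ₆ ≤ a β * L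 → |Q3 G r β L (a β) v (thetaTest 4 v) h - σ * w * Q2 G r β L (a β) (thetaTest 4 v) v| ≤ δ * w * Q2 G r β L (a β) (thetaTest 4 v) v := by
  intro G _ _ _ _ hG
  letI : MeasurableSpace G := borel G
  haveI : BorelSpace G := ⟨rfl⟩
  intro r a ha ha0
  obtain ⟨ℓ, hℓ, hℓ4, H⟩ := hSign G hG r a ha ha0
  refine ⟨ℓ, hℓ, hℓ4, fun h hshell => ?_⟩
  obtain ⟨ρ, hρ, hρℓ, Hv⟩ := H h hshell
  refine ⟨ρ, hρ, hρℓ, fun v hv0 hball hfl => ?_⟩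
  obtain ⟨σ, c, hσ, hc, β₆, Λ₆, hlow⟩ := Hv v hv0 hball hfl
  obtain ⟨ε, β₅, Λ₅, hε, hfloor⟩ := hfl
  have hρ1 : ρ < 1 := by linarith
  have hpos : tsupport (v : EuclideanSpace ℝ (Fin 4) → ℝ) ⊆ {y : EuclideanSpace ℝ (Fin 4) | 0 < y 0} :=
    fun y hy => Summit.QuantumFields.YangMills.Theorems.squeezedSkewness_pos_time_of_mem_closedBall hρ1 (hball hy)
  have hMB : MomentBounds6 G r a := hPin G hG r a ha ha0 ⟨v, ε, β₅, Λ₅, hpos, hε, hfloor⟩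
  obtain ⟨M, β₇, Λ₇, hup⟩ :=
    Summit.QuantumFields.YangMills.Theorems.CeilingFromMomentsProof.ceilingFromMoments_proof G hG r a ha ha0 hMB ℓ hℓ hℓ4 h
      hshell.2.1 ρ hρ hρℓ v hball
  set C' : ℝ := max (M / ε) (2 * c) with hC'
  have hC'c : 2 * c ≤ C' := le_max_right _ _
  have hC'M : M / ε ≤ C' := le_max_left _ _
  have hsum : 0 < C' + c := by linarith
  refine ⟨(c + C') / 2, (C' - c) / (C' + c), σ, by linarith, ?_, hσ, max β₅ (max β₆ β₇), max Λ₅ (max Λ₆ Λ₇),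
    fun β hβ L hL => ?_⟩
  · rw [div_lt_one hsum]; linarith
  have hβ5 : β₅ ≤ β := le_trans (le_max_left _ _) hβ
  have hβ6 : β₆ ≤ β := le_trans (le_trans (le_max_left _ _) (le_max_right _ _)) hβ
  have hβ7 : β₇ ≤ β := le_trans (le_trans (le_max_right _ _) (le_max_right _ _)) hβ
  have hL5 : Λ₅ ≤ a β * L := le_trans (le_max_left _ _) hL
  have hL6 : Λ₆ ≤ a β * L := le_trans (le_trans (le_max_left _ _) (le_max_right _ _)) hL
  have hL7 : Λ₇ ≤ a β * L := le_trans (le_trans (le_max_right _ _) (le_max_right _ _)) hL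
  set q : ℝ := Q2 G r β L (a β) (thetaTest 4 v) v with hq
  set t : ℝ := Q3 G r β L (a β) v (thetaTest 4 v) h with ht
  have hF : ε ≤ q := hfloor β hβ5 L hL5
  have hlo : c * q ≤ σ * t := hlow β hβ6 L hL6
  have hhi : |t| ≤ M := hup β hβ7 L hL7
  have hqpos : 0 < q := lt_of_lt_of_le hε hF
  have hM0 : 0 ≤ M := le_trans (abs_nonneg _) hhi
  have hσabs : |σ| = 1 := by rcases hσ with rfl | rfl <;> simp
  have hst : σ * t ≤ C' * q := by
    have h1 : σ * t ≤ |t| := by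
      have := le_abs_self (σ * t); rw [abs_mul, hσabs, one_mul] at this; exact this
    have h2 : M ≤ M / ε * q := by
      rw [div_mul_eq_mul_div, le_div_iff₀ hε]; exact mul_le_mul_of_nonneg_left hF hM0
    have h3 : M / ε * q ≤ C' * q := mul_le_mul_of_nonneg_right hC'M hqpos.le
    linarith
  have hkey : |σ * t - (c + C') / 2 * q| ≤ (C' - c) / 2 * q := by
    rw [abs_le]; constructor <;> nlinarith
  have hrew : t - σ * ((c + C') / 2) * q = σ * (σ * t - (c + C') / 2 * q) := by
    have hσ2 : σ * σ = 1 := by rcases hσ with rfl | rfl <;> norm_num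
    linear_combination (-t) * hσ2
  have hδw : (C' - c) / (C' + c) * ((c + C') / 2) * q = (C' - c) / 2 * q := by
    field_simp
    ring
  rw [hrew, abs_mul, hσabs, one_mul, hδw]
  exact hkey

/-! ## The parent from its two open children -/

/-- **`ShellSign → ClauseOneMoments → SqueezedFactorisation`** (item stmt-QuantumFields-25917 BY NAME): the landed glue
`squeezedSkewness_squeezedFactorisationGlue` fed with the landed children `squeezedSkewness_shellGeometry` (27860) and
`CeilingFromMomentsProof.ceilingFromMoments_proof` (27863). [folklore] -/
theorem squeezedFactorisation_of_shellSign_clauseOneMoments (hSign : ShellSign) (hPin : ClauseOneMoments) :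
    SqueezedFactorisation :=
  Summit.QuantumFields.YangMills.Theorems.squeezedSkewness_squeezedFactorisationGlue
    Summit.QuantumFields.YangMills.Theorems.squeezedSkewness_shellGeometry hSign hPin
    Summit.QuantumFields.YangMills.Theorems.CeilingFromMomentsProof.ceilingFromMoments_proof

end Summit.QuantumFields.YangMills.Theorems.SqueezedSkewnessSqueezedFactorisationStubs

end
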